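import Mathlib
import Summits.Ventures.PercRepro2.Tail2DBlockCalc
import Summits.Ventures.PercRepro2.Tail2DHarrisSP
import Summits.Ventures.PercRepro2.Tail2DFlowOneBlocks
import Summits.Ventures.PercRepro2.Tail2DFlowOneStep01

/-!
# Parallel compositions of `k` flow-one factors: letters, words and product blocks
(seat mine-b, cell pub-perc-repro2; conjectures/MINE-B.md §43)

`parFin k X` is the comb `X 0 ∥ (X 1 ∥ (… ∥ absent))` of a family `X : Fin k → SP`.  When every factor is flow-one
its configurations are classified by a WORD `wordOf k X z : Fin k → Ltr` over the three letters `R, B, C`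
(red crossing, blue crossing, no crossing), the word determines the labels (`rLab = #R`, `bLab = #B`), the
configurations with a given word form the product block `blockOf k X w` of the letter classes, whose size is the
product of the class sizes (`#R_i = #B_i`), and the tails are unions of these blocks.  Words with the same set of
`C` positions (the same T-class) have blocks of the same size when they have the same number of `B`s.
-/

namespace Summit.Ventures.PercRepro2.Tail2D

open V2Closure Finset

/-- the three letters of a flow-one factor: red crossing, blue crossing, no crossing -/
inductive Ltr : Type
  | R : Ltr
  | B : Ltr
  | C : Ltr
  deriving DecidableEq, Fintype

/-- the comb `X 0 ∥ (X 1 ∥ (… ∥ absent))` of a family of `k` terms -/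
def parFin : (k : ℕ) → (Fin k → V2Closure.SP) → V2Closure.SP
  | 0, _ => V2Closure.SP.absent
  | k + 1, X => V2Closure.SP.par (X 0) (parFin k (Fin.tail X))

/-- the letter class of a factor -/
def letterSet (s : V2Closure.SP) : Ltr → Finset s.Conf
  | .R => rSet s
  | .B => bSet s
  | .C => cellSet s

/-- the product block of a word -/
def blockOf : (k : ℕ) → (X : Fin k → V2Closure.SP) → (Fin k → Ltr) → Finset (parFin k X).Conf
  | 0, _, _ => Finset.univ
  | k + 1, X, w => (letterSet (X 0) (w 0) ×ˢ blockOf k (Fin.tail X) (Fin.tail w) :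
      Finset ((X 0).Conf × (parFin k (Fin.tail X)).Conf))

/-- the letter of a configuration of a flow-one factor -/
def letterOf (s : V2Closure.SP) (x : s.Conf) : Ltr :=
  if 1 ≤ s.rLab x then .R else if 1 ≤ s.bLab x then .B else .C

/-- the word of a configuration of the comb -/
def wordOf : (k : ℕ) → (X : Fin k → V2Closure.SP) → (parFin k X).Conf → (Fin k → Ltr)
  | 0, _, _ => Fin.elim0
  | k + 1, X, z => Fin.cons (letterOf (X 0) z.1) (wordOf k (Fin.tail X) z.2)

section Basic

/-- membership in a letter class, for a flow-one factor -/
theorem mem_letterSet_iff (s : V2Closure.SP) (hs : FlowOne s) (x : s.Conf) (a : Ltr) :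
    x ∈ letterSet s a ↔ letterOf s x = a := by
  rcases flowOne_cases s hs x with hx | hx | hx <;> cases a <;>
    simp [letterSet, letterOf, mem_rSet, mem_bSet, mem_cellSet, hx.1, hx.2]

/-- the configurations of the comb belong to the block of their word -/
theorem mem_blockOf_wordOf : ∀ (k : ℕ) (X : Fin k → V2Closure.SP), (∀ i, FlowOne (X i)) →
    ∀ z : (parFin k X).Conf, z ∈ blockOf k X (wordOf k X z)
  | 0, _, _, z => Finset.mem_univ z
  | k + 1, X, hX, z => by
      show z ∈ (letterSet (X 0) (wordOf (k + 1) X z 0) ×ˢ blockOf k (Fin.tail X) (Fin.tail (wordOf (k + 1) X z)) :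
        Finset ((X 0).Conf × (parFin k (Fin.tail X)).Conf))
      refine Finset.mem_product.2 ⟨?_, ?_⟩
      · show z.1 ∈ letterSet (X 0) (letterOf (X 0) z.1)
        exact (mem_letterSet_iff (X 0) (hX 0) z.1 _).2 rfl
      · show z.2 ∈ blockOf k (Fin.tail X) (wordOf k (Fin.tail X) z.2)
        exact mem_blockOf_wordOf k (Fin.tail X) (fun i => hX i.succ) z.2

/-- a configuration belongs to the block of a word only if that word is its word -/
theorem wordOf_eq_of_mem_blockOf : ∀ (k : ℕ) (X : Fin k → V2Closure.SP), (∀ i, FlowOne (X i)) →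
    ∀ (z : (parFin k X).Conf) (w : Fin k → Ltr), z ∈ blockOf k X w → wordOf k X z = w
  | 0, _, _, _, w, _ => Subsingleton.elim _ _
  | k + 1, X, hX, z, w, hz => by
      have hz' : z ∈ (letterSet (X 0) (w 0) ×ˢ blockOf k (Fin.tail X) (Fin.tail w) :
        Finset ((X 0).Conf × (parFin k (Fin.tail X)).Conf)) := hz
      obtain ⟨h1, h2⟩ := Finset.mem_product.1 hz'
      have e1 : letterOf (X 0) z.1 = w 0 := (mem_letterSet_iff (X 0) (hX 0) z.1 _).1 h1
      have e2 : wordOf k (Fin.tail X) z.2 = Fin.tail w :=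
        wordOf_eq_of_mem_blockOf k (Fin.tail X) (fun i => hX i.succ) z.2 (Fin.tail w) h2
      show Fin.cons (letterOf (X 0) z.1) (wordOf k (Fin.tail X) z.2) = w
      rw [e1, e2]
      exact Fin.cons_self_tail w

/-- the blocks of two different words are disjoint -/
theorem blockOf_disjoint (k : ℕ) (X : Fin k → V2Closure.SP) (hX : ∀ i, FlowOne (X i)) {w w' : Fin k → Ltr}
    (h : w ≠ w') : Disjoint (blockOf k X w) (blockOf k X w') := by
  rw [Finset.disjoint_left]
  intro z h1 h2
  exact h ((wordOf_eq_of_mem_blockOf k X hX z w h1).symm.trans (wordOf_eq_of_mem_blockOf k X hX z w' h2))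

/-- the red label of a configuration of the comb is the number of `R`s of its word -/
theorem rLab_parFin : ∀ (k : ℕ) (X : Fin k → V2Closure.SP), (∀ i, FlowOne (X i)) →
    ∀ z : (parFin k X).Conf, (parFin k X).rLab z = (Finset.univ.filter (fun i => wordOf k X z i = Ltr.R)).card
  | 0, _, _, _ => by simp [parFin, SP.rLab]
  | k + 1, X, hX, z => by
      show (X 0).rLab z.1 + (parFin k (Fin.tail X)).rLab z.2 = _
      rw [rLab_parFin k (Fin.tail X) (fun i => hX i.succ) z.2]
      have hsplit : (Finset.univ.filter (fun i : Fin (k + 1) => wordOf (k + 1) X z i = Ltr.R)).card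
          = (if letterOf (X 0) z.1 = Ltr.R then 1 else 0)
            + (Finset.univ.filter (fun i : Fin k => wordOf k (Fin.tail X) z.2 i = Ltr.R)).card := by
        rw [Finset.card_filter, Finset.card_filter, Fin.sum_univ_succ]
        simp only [wordOf, Fin.cons_zero, Fin.cons_succ]
      rw [hsplit]
      rcases flowOne_cases (X 0) (hX 0) z.1 with hx | hx | hx <;> simp [letterOf, hx.1, hx.2]

/-- the blue label of a configuration of the comb is the number of `B`s of its word -/
theorem bLab_parFin : ∀ (k : ℕ) (X : Fin k → V2Closure.SP), (∀ i, FlowOne (X i)) →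
    ∀ z : (parFin k X).Conf, (parFin k X).bLab z = (Finset.univ.filter (fun i => wordOf k X z i = Ltr.B)).card
  | 0, _, _, _ => by simp [parFin, SP.bLab]
  | k + 1, X, hX, z => by
      show (X 0).bLab z.1 + (parFin k (Fin.tail X)).bLab z.2 = _
      rw [bLab_parFin k (Fin.tail X) (fun i => hX i.succ) z.2]
      have hsplit : (Finset.univ.filter (fun i : Fin (k + 1) => wordOf (k + 1) X z i = Ltr.B)).card
          = (if letterOf (X 0) z.1 = Ltr.B then 1 else 0)
            + (Finset.univ.filter (fun i : Fin k => wordOf k (Fin.tail X) z.2 i = Ltr.B)).card := by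
        rw [Finset.card_filter, Finset.card_filter, Fin.sum_univ_succ]
        simp only [wordOf, Fin.cons_zero, Fin.cons_succ]
      rw [hsplit]
      rcases flowOne_cases (X 0) (hX 0) z.1 with hx | hx | hx <;> simp [letterOf, hx.1, hx.2]

end Basic

section Blocks

/-- the size of the block of a word is the product of the sizes of the letter classes -/
theorem card_blockOf : ∀ (k : ℕ) (X : Fin k → V2Closure.SP) (w : Fin k → Ltr),
    (blockOf k X w).card = ∏ i, (letterSet (X i) (w i)).card
  | 0, _, _ => by
      show (Finset.univ : Finset V2Closure.SP.absent.Conf).card = 1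
      rfl
  | k + 1, X, w => by
      show (letterSet (X 0) (w 0) ×ˢ blockOf k (Fin.tail X) (Fin.tail w) :
        Finset ((X 0).Conf × (parFin k (Fin.tail X)).Conf)).card = _
      rw [Finset.card_product, card_blockOf k (Fin.tail X) (Fin.tail w), Fin.prod_univ_succ]
      rfl

/-- the red and blue letter classes of a factor have the same size -/
theorem card_letterSet_R_eq_B (s : V2Closure.SP) : (letterSet s .R).card = (letterSet s .B).card := by
  show (rSet s).card = (bSet s).card
  exact (card_bSet_eq s).symm

/-- the letter classes of a flow-one factor are ordered `R ≼ B` and each class dominates itself -/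
theorem letterSet_dom (s : V2Closure.SP) (a b : Ltr) (h : a = b ∨ (a = .R ∧ b = .B)) :
    BlockDom s (letterSet s a) (letterSet s b) := by
  rcases h with rfl | ⟨rfl, rfl⟩
  · exact blockDom_refl s _
  · exact dom_r_b s

/-- **the product coupling of two words**: turning some `R`s into `B`s dominates the block -/
theorem blockOf_dom : ∀ (k : ℕ) (X : Fin k → V2Closure.SP) (w w' : Fin k → Ltr),
    (∀ i, w i = w' i ∨ (w i = .R ∧ w' i = .B)) → BlockDom (parFin k X) (blockOf k X w) (blockOf k X w')
  | 0, _, _, _, _ => blockDom_refl _ _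
  | k + 1, X, w, w', h => by
      show BlockDom (V2Closure.SP.par (X 0) (parFin k (Fin.tail X)))
        (letterSet (X 0) (w 0) ×ˢ blockOf k (Fin.tail X) (Fin.tail w))
        (letterSet (X 0) (w' 0) ×ˢ blockOf k (Fin.tail X) (Fin.tail w'))
      exact blockDom_prod_par _ _ (letterSet_dom (X 0) _ _ (h 0))
        (blockOf_dom k (Fin.tail X) (Fin.tail w) (Fin.tail w') (fun i => h i.succ))

variable (k : ℕ) (X : Fin k → V2Closure.SP)

/-- the number of `R`s, `B`s of a word -/
def nR (w : Fin k → Ltr) : ℕ := (Finset.univ.filter (fun i => w i = Ltr.R)).card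
/-- the number of `B`s of a word -/
def nB (w : Fin k → Ltr) : ℕ := (Finset.univ.filter (fun i => w i = Ltr.B)).card

/-- membership in a tail, by the word -/
theorem mem_tailSet_parFin (hX : ∀ i, FlowOne (X i)) (a c : ℕ) (z : (parFin k X).Conf) :
    z ∈ tailSet (parFin k X) a c ↔ a ≤ nR k (wordOf k X z) ∧ c ≤ nB k (wordOf k X z) := by
  rw [mem_tailSet_iff, rLab_parFin k X hX, bLab_parFin k X hX]
  rfl

/-- the uniform density of a block at a configuration: `1/#block` on the block of its word, `0` elsewhere -/
theorem unifDens_blockOf (hX : ∀ i, FlowOne (X i)) (w : Fin k → Ltr) (z : (parFin k X).Conf) :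
    unifDens (parFin k X) (blockOf k X w) z
      = if wordOf k X z = w then ((blockOf k X w).card : ℚ)⁻¹ else 0 := by
  unfold unifDens
  by_cases h : wordOf k X z = w
  · subst h
    rw [if_pos (mem_blockOf_wordOf k X hX z), if_pos rfl]
  · rw [if_neg (fun hz => h (wordOf_eq_of_mem_blockOf k X hX z w hz)), if_neg h]

/-- the block of the word of a configuration is non-empty -/
theorem card_blockOf_wordOf_pos (hX : ∀ i, FlowOne (X i)) (z : (parFin k X).Conf) :
    0 < (blockOf k X (wordOf k X z)).card :=
  Finset.card_pos.2 ⟨z, mem_blockOf_wordOf k X hX z⟩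

/-- a tail is the union of the blocks of its words, so its size is the sum of the block sizes -/
theorem tailCount_parFin_eq_sum (hX : ∀ i, FlowOne (X i)) (a c : ℕ) :
    tailCount (parFin k X) a c
      = ∑ w ∈ (Finset.univ.filter (fun w : Fin k → Ltr => a ≤ nR k w ∧ c ≤ nB k w)), (blockOf k X w).card := by
  rw [tailCount_eq_card]
  have hdisj : ∀ w ∈ (Finset.univ.filter (fun w : Fin k → Ltr => a ≤ nR k w ∧ c ≤ nB k w)),
      ∀ w' ∈ (Finset.univ.filter (fun w : Fin k → Ltr => a ≤ nR k w ∧ c ≤ nB k w)), w ≠ w' →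
        Disjoint (blockOf k X w) (blockOf k X w') := fun w _ w' _ h => blockOf_disjoint k X hX h
  rw [← Finset.card_biUnion hdisj]
  congr 1
  ext z
  rw [mem_tailSet_parFin k X hX, Finset.mem_biUnion]
  constructor
  · intro h
    exact ⟨wordOf k X z, by simpa using h, mem_blockOf_wordOf k X hX z⟩
  · rintro ⟨w, hw, hz⟩
    rw [wordOf_eq_of_mem_blockOf k X hX z w hz]
    simpa using hw

end Blocks

end Summit.Ventures.PercRepro2.Tail2D
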